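import Mathlib
import HarnessLib
import Summits.NavierStokesRegularity.NavierStokesRegularity.Theorems.PoloidalWindowDoorPoloidalWindowRigidityLrcJetKernel
import Summits.NavierStokesRegularity.NavierStokesRegularity.Theorems.PoloidalWindowDoorPoloidalWindowRigidityLrcJetKernel2
import Summits.NavierStokesRegularity.NavierStokesRegularity.Theorems.PoloidalWindowDoorPoloidalWindowRigidityLrcJetKernelN12Base
import Summits.NavierStokesRegularity.NavierStokesRegularity.Theorems.PoloidalWindowDoorPoloidalWindowRigidityLrcJetKernelN12K3T1
import Summits.NavierStokesRegularity.NavierStokesRegularity.Theorems.PoloidalWindowDoorPoloidalWindowRigidityLrcJetKernelN12K3T2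
import Summits.NavierStokesRegularity.NavierStokesRegularity.Theorems.PoloidalWindowDoorPoloidalWindowRigidityLrcJetKernelN12K3T3
import Summits.NavierStokesRegularity.NavierStokesRegularity.Theorems.PoloidalWindowDoorPoloidalWindowRigidityLrcJetKernelN12K3T4
import Summits.NavierStokesRegularity.NavierStokesRegularity.Theorems.PoloidalWindowDoorPoloidalWindowRigidityLrcJetKernelN12K3T5
/-!
# Line `lrc-jet` of crux K2 `PoloidalWindowRigidity` — exact jet certificate, STEADY, order N = 12, k = 3 — light identities and assembly

Cell ns-regularity-ideate, seat ns-poloidal-K2-cert-1 (exact jet-certificate engineer under the K2 lead), 2026-08-27.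
Bears on LADDER-NS N0 (route `PoloidalWindowDoor`, crux stmt-NavierStokesRegularity-19708, line lrc-jet v2, stub `stub_lrcSpatial`).

THE DATUM.  `jstar` (`…LrcJetKernelN12Base`) is an explicit rational axisymmetric steady poloidal Navier–Stokes 12-jet with
non-constant Clebsch slope (`Λ(0) = 2`, `∇Λ(0) = (0,−4,0)`).  Its Zariski tangent space in the free-pressure steady poloidal jet scheme
`V₁₂` (pins `v(0)`, `Dv(0)` fixed) is the common kernel of the 1584 generated rows `rowGen2 jstar3 (rowOfIndex 12 r)`.  EXACT RESULT
(seat engine; kit j274554 / j274767 / j275168; ranks over `ℚ` by multimodular integer arithmetic): every tangent vector has a vorticity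
variation that is infinitesimally Killing-symmetric — `L_{K*}δω + L_{δK}ω* = O(|x|^{k−1})` for some `δK ∈ span{Jx, e₀, e₁, e₂}` — for all
`k ≤ 7`, and `ρ(k,N) = 0 ⇔ k ≤ N−5` for every `N ∈ [12,17]` (four pin sets), false at `N ≤ 11`; unsteady: `N* = 13`.  The `k = 3`
block is replayed here: nine explicit functionals `c₀,…,c₈` of the 3-jet coordinates span the annihilator of the Killing-symmetric
first-order vorticity jets, and for each an exact identity `Σ_r y_r J_r = D_t·c_t` (integer weights, heights ≤ 130 bits) is checked,
whence `(∀ r, ⟨J_r, δ⟩ = 0) → ⟨c_t, δ⟩ = 0`.\n\nTHIS FILE: the four light identities (t = 0,6,7,8) and the assembled theorem `tangent_annihilated` (all nine functionals).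

WHAT THIS IS NOT: not a statement about Navier–Stokes regularity, not LRC″, not the registered stub — an exact linear-algebra
datum about ONE explicit symmetric jet (the one-point, jet-level, LINEARISED form of the line's local rigidity conjecture); the
identification of the generated rows with the linearised PDE is documented in `…LrcJetKernel` §1 and cross-checked against the
seat's exact engine by `decide +kernel`, not proved in Lean.  All identities here are checked by the KERNEL (`decide +kernel`;
no `native_decide`, no extra axioms).
-/

set_option linter.dupNamespace false
set_option autoImplicit false

namespace Summit.NavierStokesRegularity.NavierStokesRegularity.Theorems.PoloidalWindowDoorPoloidalWindowRigidityLrcJetKernelN12K3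

open Summit.NavierStokesRegularity.NavierStokesRegularity.Theorems.PoloidalWindowDoorPoloidalWindowRigidityLrcJetKernel
open Summit.NavierStokesRegularity.NavierStokesRegularity.Theorems.PoloidalWindowDoorPoloidalWindowRigidityLrcJetKernel2
open Summit.NavierStokesRegularity.NavierStokesRegularity.Theorems.PoloidalWindowDoorPoloidalWindowRigidityLrcJetKernelN12Base
open Summit.NavierStokesRegularity.NavierStokesRegularity.Theorems.PoloidalWindowDoorPoloidalWindowRigidityLrcJetKernelN12K3T1
open Summit.NavierStokesRegularity.NavierStokesRegularity.Theorems.PoloidalWindowDoorPoloidalWindowRigidityLrcJetKernelN12K3T2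
open Summit.NavierStokesRegularity.NavierStokesRegularity.Theorems.PoloidalWindowDoorPoloidalWindowRigidityLrcJetKernelN12K3T3
open Summit.NavierStokesRegularity.NavierStokesRegularity.Theorems.PoloidalWindowDoorPoloidalWindowRigidityLrcJetKernelN12K3T4
open Summit.NavierStokesRegularity.NavierStokesRegularity.Theorems.PoloidalWindowDoorPoloidalWindowRigidityLrcJetKernelN12K3T5

-- certificate t=0 (k=3): 1 weighted Jacobian rows, integer weights ≤ 2 bits, divisor D_0 (1 bits)
/-- row indices of certificate 0. -/
def yRows0_0 : List ℕ := [8]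

/-- row indices of certificate 0 (concatenated). -/
def yRows0 : List ℕ := yRows0_0

/-- integer weights of certificate 0. -/
def yW0_0 : List ℤ := [(-2)]

/-- integer weights of certificate 0 (concatenated). -/
def yW0 : List ℤ := yW0_0

/-- divisor `D_0`. -/
def yD0 : ℤ := 1

/-- functional `c_0`: tangent-coordinate indices (global column order, `…LrcJetKernel` §1). -/
def cCols0 : List ℕ := [4, 11]
/-- functional `c_0`: integer coefficients. -/
def cVals0 : List ℤ := [2, (-4)]
/-- the functional `c_0` (a sparse vector over the tangent coordinates). -/
def c0 : SpVec := mkC cCols0 cVals0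

set_option maxHeartbeats 40000000 in
set_option maxRecDepth 2000000 in
/-- kernel replay of the exact identity `Σ_r y_r J_r(jstar) = D_0·c_0` (1 rows). -/
theorem certCheck2_t0 :
    certCheck2 40000 jstar3 (mkY 12 yRows0 yW0) (yD0 : ℚ) c0 = true := by
  decide +kernel

/-- all row indices of certificate 0 are `< 1584`. -/
theorem yRows0_lt : yRows0.all (fun r => decide (r < 1584)) = true := by decide +kernel

/-- `D_0 ≠ 0`. -/
theorem yD0_ne : (yD0 : ℚ) ≠ 0 := by norm_num [yD0]

/-- every tangent vector of the steady poloidal 12-jet scheme at `jstar` is annihilated by `c_0`. -/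
theorem annihilated_t0 (δ : ℕ → ℚ)
    (hJ : ∀ r, r < 1584 → dot (rowGen2 jstar3 (rowOfIndex 12 r)) δ = 0) : dot c0 δ = 0 :=
  dot_eq_zero_of_certCheck2_mkY 40000 12 jstar3 yRows0 yW0 (yD0 : ℚ) c0 1584 yRows0_lt yD0_ne certCheck2_t0 δ hJ

-- certificate t=6 (k=3): 1 weighted Jacobian rows, integer weights ≤ 2 bits, divisor D_6 (1 bits)
/-- row indices of certificate 6. -/
def yRows6_0 : List ℕ := [27]

/-- row indices of certificate 6 (concatenated). -/
def yRows6 : List ℕ := yRows6_0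

/-- integer weights of certificate 6. -/
def yW6_0 : List ℤ := [(-2)]

/-- integer weights of certificate 6 (concatenated). -/
def yW6 : List ℤ := yW6_0

/-- divisor `D_6`. -/
def yD6 : ℤ := 1

/-- functional `c_6`: tangent-coordinate indices (global column order, `…LrcJetKernel` §1). -/
def cCols6 : List ℕ := [26, 38]
/-- functional `c_6`: integer coefficients. -/
def cVals6 : List ℤ := [2, (-4)]
/-- the functional `c_6` (a sparse vector over the tangent coordinates). -/
def c6 : SpVec := mkC cCols6 cVals6

set_option maxHeartbeats 40000000 in
set_option maxRecDepth 2000000 in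
/-- kernel replay of the exact identity `Σ_r y_r J_r(jstar) = D_6·c_6` (1 rows). -/
theorem certCheck2_t6 :
    certCheck2 40000 jstar3 (mkY 12 yRows6 yW6) (yD6 : ℚ) c6 = true := by
  decide +kernel

/-- all row indices of certificate 6 are `< 1584`. -/
theorem yRows6_lt : yRows6.all (fun r => decide (r < 1584)) = true := by decide +kernel

/-- `D_6 ≠ 0`. -/
theorem yD6_ne : (yD6 : ℚ) ≠ 0 := by norm_num [yD6]

/-- every tangent vector of the steady poloidal 12-jet scheme at `jstar` is annihilated by `c_6`. -/
theorem annihilated_t6 (δ : ℕ → ℚ)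
    (hJ : ∀ r, r < 1584 → dot (rowGen2 jstar3 (rowOfIndex 12 r)) δ = 0) : dot c6 δ = 0 :=
  dot_eq_zero_of_certCheck2_mkY 40000 12 jstar3 yRows6 yW6 (yD6 : ℚ) c6 1584 yRows6_lt yD6_ne certCheck2_t6 δ hJ

-- certificate t=7 (k=3): 2 weighted Jacobian rows, integer weights ≤ 2 bits, divisor D_7 (1 bits)
/-- row indices of certificate 7. -/
def yRows7_0 : List ℕ := [8, 28]

/-- row indices of certificate 7 (concatenated). -/
def yRows7 : List ℕ := yRows7_0

/-- integer weights of certificate 7. -/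
def yW7_0 : List ℤ := [(-1), (-2)]

/-- integer weights of certificate 7 (concatenated). -/
def yW7 : List ℤ := yW7_0

/-- divisor `D_7`. -/
def yD7 : ℤ := 1

/-- functional `c_7`: tangent-coordinate indices (global column order, `…LrcJetKernel` §1). -/
def cCols7 : List ℕ := [4, 11, 27, 39]
/-- functional `c_7`: integer coefficients. -/
def cVals7 : List ℤ := [1, (-2), 4, (-4)]
/-- the functional `c_7` (a sparse vector over the tangent coordinates). -/
def c7 : SpVec := mkC cCols7 cVals7

set_option maxHeartbeats 40000000 in
set_option maxRecDepth 2000000 in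
/-- kernel replay of the exact identity `Σ_r y_r J_r(jstar) = D_7·c_7` (2 rows). -/
theorem certCheck2_t7 :
    certCheck2 40000 jstar3 (mkY 12 yRows7 yW7) (yD7 : ℚ) c7 = true := by
  decide +kernel

/-- all row indices of certificate 7 are `< 1584`. -/
theorem yRows7_lt : yRows7.all (fun r => decide (r < 1584)) = true := by decide +kernel

/-- `D_7 ≠ 0`. -/
theorem yD7_ne : (yD7 : ℚ) ≠ 0 := by norm_num [yD7]

/-- every tangent vector of the steady poloidal 12-jet scheme at `jstar` is annihilated by `c_7`. -/
theorem annihilated_t7 (δ : ℕ → ℚ)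
    (hJ : ∀ r, r < 1584 → dot (rowGen2 jstar3 (rowOfIndex 12 r)) δ = 0) : dot c7 δ = 0 :=
  dot_eq_zero_of_certCheck2_mkY 40000 12 jstar3 yRows7 yW7 (yD7 : ℚ) c7 1584 yRows7_lt yD7_ne certCheck2_t7 δ hJ

-- certificate t=8 (k=3): 6 weighted Jacobian rows, integer weights ≤ 3 bits, divisor D_8 (1 bits)
/-- row indices of certificate 8. -/
def yRows8_0 : List ℕ := [6, 7, 10, 14, 24, 26]

/-- row indices of certificate 8 (concatenated). -/
def yRows8 : List ℕ := yRows8_0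

/-- integer weights of certificate 8. -/
def yW8_0 : List ℤ := [(-2), (-1), (-2), 2, 4, 4]

/-- integer weights of certificate 8 (concatenated). -/
def yW8 : List ℤ := yW8_0

/-- divisor `D_8`. -/
def yD8 : ℤ := 1

/-- functional `c_8`: tangent-coordinate indices (global column order, `…LrcJetKernel` §1). -/
def cCols8 : List ℕ := [2, 10, 29, 40]
/-- functional `c_8`: integer coefficients. -/
def cVals8 : List ℤ := [(-2), 1, 4, (-12)]
/-- the functional `c_8` (a sparse vector over the tangent coordinates). -/
def c8 : SpVec := mkC cCols8 cVals8

set_option maxHeartbeats 40000000 in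
set_option maxRecDepth 2000000 in
/-- kernel replay of the exact identity `Σ_r y_r J_r(jstar) = D_8·c_8` (6 rows). -/
theorem certCheck2_t8 :
    certCheck2 40000 jstar3 (mkY 12 yRows8 yW8) (yD8 : ℚ) c8 = true := by
  decide +kernel

/-- all row indices of certificate 8 are `< 1584`. -/
theorem yRows8_lt : yRows8.all (fun r => decide (r < 1584)) = true := by decide +kernel

/-- `D_8 ≠ 0`. -/
theorem yD8_ne : (yD8 : ℚ) ≠ 0 := by norm_num [yD8]

/-- every tangent vector of the steady poloidal 12-jet scheme at `jstar` is annihilated by `c_8`. -/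
theorem annihilated_t8 (δ : ℕ → ℚ)
    (hJ : ∀ r, r < 1584 → dot (rowGen2 jstar3 (rowOfIndex 12 r)) δ = 0) : dot c8 δ = 0 :=
  dot_eq_zero_of_certCheck2_mkY 40000 12 jstar3 yRows8 yW8 (yD8 : ℚ) c8 1584 yRows8_lt yD8_ne certCheck2_t8 δ hJ

/-- **Kernel-replayed exact certificate (steady, N = 12, k = 3).**  Every Zariski tangent vector `δ` of the steady
free-pressure poloidal jet scheme at the axisymmetric 12-jet `jstar` (every coefficient vector annihilated by all 1584 generated
Jacobian rows) is annihilated by the nine functionals `c₀, …, c₈`, i.e. its vorticity 1-jet variation is Killing-symmetric to first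
order modulo a moving Killing field in `span{Jx,e₀,e₁,e₂}` (e.g. `c₂ = −2δv₀[xz] − δv₁[yz] + 2δv₂[yy] + 4δv₂[xx] + 4δv₁[xxz] − 4δv₂[xxy]`).
The jet-level, one-point, linearised shadow of `stub_lrcSpatial`; see the module docstring for what it is NOT. -/
theorem tangent_annihilated (δ : ℕ → ℚ)
    (hJ : ∀ r, r < 1584 → dot (rowGen2 jstar3 (rowOfIndex 12 r)) δ = 0) :
    dot c0 δ = 0 ∧
    dot c1 δ = 0 ∧
    dot c2 δ = 0 ∧
    dot c3 δ = 0 ∧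
    dot c4 δ = 0 ∧
    dot c5 δ = 0 ∧
    dot c6 δ = 0 ∧
    dot c7 δ = 0 ∧
    dot c8 δ = 0 :=
  ⟨annihilated_t0 δ hJ, annihilated_t1 δ hJ, annihilated_t2 δ hJ, annihilated_t3 δ hJ, annihilated_t4 δ hJ, annihilated_t5 δ hJ, annihilated_t6 δ hJ, annihilated_t7 δ hJ, annihilated_t8 δ hJ⟩

end Summit.NavierStokesRegularity.NavierStokesRegularity.Theorems.PoloidalWindowDoorPoloidalWindowRigidityLrcJetKernelN12K3
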